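import Summits.QuantumAdvantage.QuantumAdvantage.Theorems.LinnikCubicClassGroupsDegreeOnePrimesEscapeSplittingTypePNT
import Summits.QuantumAdvantage.QuantumAdvantage.Theorems.LinnikCubicClassGroupsDegreeOnePrimesEscapeSplittingTypePNTPureCubic
import HarnessLib

/-!
# The Chebotarev density theorem for non-Galois cubic fields in the Linnik range

Topic `Summits/QuantumAdvantage/QuantumAdvantage/Theorems`, cell B2b-1 (linnik-cubic), PART A (gen 11);
helper toward the crux `DegreeOnePrimesEscape` (stmt-QuantumAdvantage-11543) of route
`LinnikCubicClassGroups`.  HONEST FRAMING: the value of this file is a THEOREM (kernel-checked, GRH-free,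
Siegel-free, no hypothesis) — NOT summit progress.

**Theorem** (`splittingType_PNT_cubic`), the case `n = 3` of `splittingType_PNT_of_symmetric` with the
`S₃` bookkeeping made explicit.  For `0 < ε ≤ 1` there are absolute `L > 0`, `0 < c ≤ 1/4` such that for
every cubic number field `K` that is NOT Galois over `ℚ` (complex cubic fields, pure cubic fields, all cubic
fields of non-square discriminant) there are `θ ∈ {0,1}` and `β₁ ∈ (1 − c/(log|d_K| + log 4), 1)` with, for
all `x ≥ |d_K|^L` (`Li = offsetLogIntegral`, all primes `p ≤ x` counted):

  `|#{p ≤ x : p splits completely in K} − (Li(x) − θ Li(x^{β₁}))/6| ≤ ε (Li(x) − θ Li(x^{β₁}))/6`,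
  `|#{p ≤ x : splitting type (1,2)}    − (Li(x) + θ Li(x^{β₁}))/2| ≤ ε (Li(x) + θ Li(x^{β₁}))/2`,
  `|#{p ≤ x : p inert in K}            − (Li(x) − θ Li(x^{β₁}))/3| ≤ ε (Li(x) − θ Li(x^{β₁}))/3`.

Here `θ = 1` exactly when the Dedekind zeta function of the Galois closure `N = K(√d_K)` has a real zero
`β₁` in the window — a zero of `L(s, χ_{d_K})`, the quadratic resolvent — and the secondary term enters with
the sign of the Frobenius class in `S₃` (`+` on the transpositions).  Lagarias–Montgomery–Odlyzko /
Thorner–Zaman for `S₃` [LagariasMontgomeryOdlyzko1979, Thm 1.1; ThornerZaman2019, Thm 1.4]; unconditional,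
`L(ε)`, `c(ε)` inexplicit.  For the pure cubic fields `θ = 0` always (`splittingType_PNT_pureCubic`).
-/

noncomputable section

open scoped NumberField nonZeroDivisors
open Finset Real Ideal NumberField
open Literature.NumberTheory.NumberFields Literature.NumberTheory.LFunctions
  Literature.NumberTheory.LFunctions.NumberField

namespace Summit.QuantumAdvantage.QuantumAdvantage.Theorems.DegreeOnePrimesEscape

set_option maxHeartbeats 4000000 in
/-- **The Chebotarev density theorem for non-Galois cubic fields in the Linnik range** (see the module
docstring): densities `1/6, 1/2, 1/3`, secondary term `∓ θ Li(x^{β₁})` with `θ ∈ {0,1}` and the sign of the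
class, relative error `ε`, all `x ≥ |d_K|^L`.  Unconditional.
[cite: LagariasMontgomeryOdlyzko1979, Theorem 1.1] [cite: ThornerZaman2019, Theorem 1.4] -/
theorem splittingType_PNT_cubic {ε : ℝ} (hε : 0 < ε) (hε1 : ε ≤ 1) :
    ∃ L c : ℝ, 0 < L ∧ 0 < c ∧ c ≤ 1 / 4 ∧ ∀ (K : Type) [Field K] [NumberField K], Module.finrank ℚ K = 3 →
      ¬ IsGalois ℚ K →
      ∃ θ β₁ : ℝ, (θ = 0 ∨ θ = 1) ∧
        1 - c / (Real.log ((NumberField.discr K).natAbs : ℝ) + Real.log 4) < β₁ ∧ β₁ < 1 ∧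
        ∀ x : ℝ, ((NumberField.discr K).natAbs : ℝ) ^ L ≤ x →
          |((((Nat.primesLE ⌊x⌋₊).filter (fun p : ℕ => splittingType K p = {1, 1, 1})).card : ℕ) : ℝ) -
              (offsetLogIntegral x - θ * offsetLogIntegral (x ^ β₁)) / 6| ≤
            ε * ((offsetLogIntegral x - θ * offsetLogIntegral (x ^ β₁)) / 6) ∧
          |((((Nat.primesLE ⌊x⌋₊).filter (fun p : ℕ => splittingType K p = {1, 2})).card : ℕ) : ℝ) -
              (offsetLogIntegral x + θ * offsetLogIntegral (x ^ β₁)) / 2| ≤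
            ε * ((offsetLogIntegral x + θ * offsetLogIntegral (x ^ β₁)) / 2) ∧
          |((((Nat.primesLE ⌊x⌋₊).filter (fun p : ℕ => splittingType K p = {3})).card : ℕ) : ℝ) -
              (offsetLogIntegral x - θ * offsetLogIntegral (x ^ β₁)) / 3| ≤
            ε * ((offsetLogIntegral x - θ * offsetLogIntegral (x ^ β₁)) / 3) := by
  obtain ⟨L, c, hL, hc, hc4, h⟩ := splittingType_PNT_of_symmetric 3 (by norm_num) hε hε1
  refine ⟨L, c, hL, hc, hc4, fun K _ _ h3 hKng => ?_⟩
  obtain ⟨θ, β₁, hθ, hβ₁c, hβ₁1, hT⟩ :=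
    h K h3 (fun M _ _ _ f => factorial_three_le_finrank_of_not_isGalois h3 hKng M f)
  refine ⟨θ, β₁, hθ, hβ₁c, hβ₁1, fun x hx => ?_⟩
  -- the three densities `1/6, 3/6, 2/6` and signs `+, −, +`
  have c111 : (Finset.univ.filter fun q : Equiv.Perm (Fin 3) =>
      q.cycleType + Multiset.replicate (3 - q.support.card) 1 = {1, 1, 1}).card = 1 := by decide
  have c12 : (Finset.univ.filter fun q : Equiv.Perm (Fin 3) =>
      q.cycleType + Multiset.replicate (3 - q.support.card) 1 = {1, 2}).card = 3 := by decide
  have c3 : (Finset.univ.filter fun q : Equiv.Perm (Fin 3) =>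
      q.cycleType + Multiset.replicate (3 - q.support.card) 1 = {3}).card = 2 := by decide
  have k111 : 3 - Multiset.card ({1, 1, 1} : Multiset ℕ) = 0 := by decide
  have k12 : 3 - Multiset.card ({1, 2} : Multiset ℕ) = 1 := by decide
  have k3 : 3 - Multiset.card ({3} : Multiset ℕ) = 2 := by decide
  have hfac : ((Nat.factorial 3 : ℕ) : ℝ) = 6 := by norm_num [Nat.factorial]
  refine ⟨?_, ?_, ?_⟩
  · have := hT {1, 1, 1} (by decide) (by decide) x hx
    rw [c111, k111, hfac] at this
    have e1 : (((1 : ℕ) : ℝ)) / 6 * (offsetLogIntegral x - θ * (-1 : ℝ) ^ 0 * offsetLogIntegral (x ^ β₁)) =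
        (offsetLogIntegral x - θ * offsetLogIntegral (x ^ β₁)) / 6 := by push_cast; ring
    rwa [e1] at this
  · have := hT {1, 2} (by decide) (by decide) x hx
    rw [c12, k12, hfac] at this
    have e1 : (((3 : ℕ) : ℝ)) / 6 * (offsetLogIntegral x - θ * (-1 : ℝ) ^ 1 * offsetLogIntegral (x ^ β₁)) =
        (offsetLogIntegral x + θ * offsetLogIntegral (x ^ β₁)) / 2 := by push_cast; ring
    rwa [e1] at this
  · have := hT {3} (by decide) (by decide) x hx
    rw [c3, k3, hfac] at this
    have e1 : (((2 : ℕ) : ℝ)) / 6 * (offsetLogIntegral x - θ * (-1 : ℝ) ^ 2 * offsetLogIntegral (x ^ β₁)) =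
        (offsetLogIntegral x - θ * offsetLogIntegral (x ^ β₁)) / 3 := by push_cast; ring
    rwa [e1] at this

end Summit.QuantumAdvantage.QuantumAdvantage.Theorems.DegreeOnePrimesEscape

end
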